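import Summits.AtomisticToContinuum.BoseEinsteinCondensation.Theorems.BECGroundStateSOSPeriodicIRBoundZeroMomentumGapBounded
import Summits.AtomisticToContinuum.BoseEinsteinCondensation.Theorems.PeriodicIRBound.Negative.AEClass
import HarnessLib

/-!
# Crux `PeriodicIRBound` (stmt-AtomisticToContinuum-3972), line `linear-ph-floor-wagner` —
# stub 3a′: the zero-momentum gap for ESSENTIALLY bounded admissible potentials

Helper file of the line lead (seat c1), sharpening stub 3a
(`Theorems/BECGroundStateSOSPeriodicIRBoundZeroMomentumGapBounded.lean`, `zeroMomentumGapFor_of_bounded`: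
the fixed-`(N,L)` zero-momentum gap for admissible `v` with `v ≤ M < ⊤` everywhere) to the canonical
measure-theoretic class: admissible `v` with `v(|x|) ≤ M < ⊤` for ALMOST EVERY `x ∈ ℝ³`
(`zeroMomentumGapFor_of_ae_bounded`; registered skeleton stub `stub_zeroMomentumGroundAEBounded`). The
periodic quadratic form — hence `E₀^per`, the momentum-sector energies and `ZeroMomentumGapFor` — sees the
profile only through the a.e.-class of `x ↦ v(|x|)` (Disproof §21, landed `Negative/AEClass.lean`:
`periodicGroundStateEnergy_congr_ae`, `momentumSectorEnergy_congr_ae`), and the truncation `min(v, M)` is an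
admissible bounded profile in that class. So the residual of the pooled item stmt-AtomisticToContinuum-11845
left open by the line (stub 3b′) is exactly the class of integrable admissible profiles with
`x ↦ v(|x|) ∉ L^∞(ℝ³)`.

References: M. Reed, B. Simon, *Methods of Modern Mathematical Physics IV* (1978) §XIII.12.
-/

noncomputable section

open scoped BigOperators ENNReal
open Filter MeasureTheory

namespace Summit.AtomisticToContinuum.BoseEinsteinCondensation.Cruxes.PeriodicIRBound.LinearPhFloorWagner

open Literature.MathematicalPhysics.QuantumManyBody.BoseGas
open Summit.AtomisticToContinuum.BoseEinsteinCondensation.Theorems.PeriodicIRBound.Negative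
  (periodicGroundStateEnergy_congr_ae momentumSectorEnergy_congr_ae)

/-- **`ZeroMomentumGapFor` depends only on the a.e.-class of `x ↦ v(|x|)`.** [folklore] -/
theorem zeroMomentumGapFor_congr_ae {v w : ℝ → ℝ≥0∞} (h : ∀ᵐ x : Space, v ‖x‖ = w ‖x‖) :
    ZeroMomentumGapFor v ↔ ZeroMomentumGapFor w := by
  unfold ZeroMomentumGapFor
  simp only [periodicGroundStateEnergy_congr_ae h, momentumSectorEnergy_congr_ae h]

/-- The truncation `min(v, M)` of an admissible profile is admissible. [folklore] -/
theorem isRepulsiveFiniteRange_min {v : ℝ → ℝ≥0∞} (hv : IsRepulsiveFiniteRange v) (M : ℝ≥0∞) :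
    IsRepulsiveFiniteRange fun r => min (v r) M := by
  obtain ⟨hmeas, R₀, hR₀⟩ := hv
  refine ⟨hmeas.min measurable_const, R₀, fun r hr => ?_⟩
  simp only [hR₀ r hr]
  exact min_eq_left bot_le

/-- **Zero-momentum gap for ESSENTIALLY bounded admissible potentials**: if `v(|x|) ≤ M < ⊤` for a.e.
`x ∈ ℝ³` then `E₀^per(N,L) < E^per_N(q;L)` for every `N`, `L > 0`, `q ≠ 0` — the profile is a.e.-equal to
its admissible bounded truncation `min(v, M)`, to which `zeroMomentumGapFor_of_bounded` applies.
[cite: ReedSimonIV1978, §XIII.12 Thms XIII.43–XIII.47] -/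
theorem zeroMomentumGapFor_of_ae_bounded {v : ℝ → ℝ≥0∞} (hv : IsRepulsiveFiniteRange v)
    (hM : ∃ M : ℝ≥0∞, M ≠ ⊤ ∧ ∀ᵐ x : Space, v ‖x‖ ≤ M) : ZeroMomentumGapFor v := by
  obtain ⟨M, hMtop, hae⟩ := hM
  have h : ∀ᵐ x : Space, v ‖x‖ = (fun r => min (v r) M) ‖x‖ := by
    filter_upwards [hae] with x hx
    exact (min_eq_left hx).symm
  exact (zeroMomentumGapFor_congr_ae h).2
    (zeroMomentumGapFor_of_bounded (isRepulsiveFiniteRange_min hv M) ⟨M, hMtop, fun r => min_le_right _ _⟩)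

/-- **Registered stub `stub_zeroMomentumGroundAEBounded` of the crux skeleton** (stub 3a′ of line
`linear-ph-floor-wagner`), verbatim signature. [cite: ReedSimonIV1978, §XIII.12 Thms XIII.43–XIII.47] -/
theorem stub_zeroMomentumGroundAEBounded :
    ∀ v : ℝ → ℝ≥0∞, IsRepulsiveFiniteRange v → (∃ M : ℝ≥0∞, M ≠ ⊤ ∧ ∀ᵐ x : Space, v ‖x‖ ≤ M) →
      ZeroMomentumGapFor v :=
  fun _ hv hM => zeroMomentumGapFor_of_ae_bounded hv hM

/-- Everywhere-bounded profiles are essentially bounded (so stub 3a is the special case). [folklore] -/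
theorem ae_bounded_of_bounded {v : ℝ → ℝ≥0∞} (hM : ∃ M : ℝ≥0∞, M ≠ ⊤ ∧ ∀ r, v r ≤ M) :
    ∃ M : ℝ≥0∞, M ≠ ⊤ ∧ ∀ᵐ x : Space, v ‖x‖ ≤ M := by
  obtain ⟨M, hMtop, hvM⟩ := hM
  exact ⟨M, hMtop, Eventually.of_forall fun x => hvM _⟩

end Summit.AtomisticToContinuum.BoseEinsteinCondensation.Cruxes.PeriodicIRBound.LinearPhFloorWagner

end
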